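import HarnessLib
import Literature.Geometry.DiscreteGeometry.KissingPatterns
import Literature.MathematicalPhysics.StatisticalMechanics.BarlowStacking
import Summits.AtomisticToContinuum.Crystallization.Theorems.LayeredLawsSelectHcp.Negative.HcpShells
import Summits.AtomisticToContinuum.Crystallization.Theorems.HullExactificationCascadeExactHcpLocalTheoremShell

/-!
# Line `birth` of crux `FreeSplittingCertificates.ShellRigidityHcp`
# (stmt-AtomisticToContinuum-12561): stub `stub_shellIdentification` — the stretched shell is
# the first cluster of the stretched crystal

Write `S(a,t) := hcpKissingPattern.image (u ↦ a • (u + (t (u₀+u₁+u₂)/3) • (1,1,1)))`: the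
anticuboctahedron (hexagon in the plane `x + y + z = 0`, caps at heights `±√(2/3)` along
`(1,1,1)/√3`), scaled by `a`, with its caps pushed to heights `±(1+t)√(2/3)·a`.  We prove that
the close-packing frame `B := hexIso` of the tree (rows `(1,−1,0)/√2`, `(−1,−1,2)/√6`,
`(1,1,1)/√3`; `LayeredLawsSelectHcp.Negative.HexCubic`) carries `S(a,t)` EXACTLY onto the
punctured first cluster `{p ∈ hcpStacking a h | p ≠ 0, ‖p‖ < 13a/10}` of the stretched crystal,
`h := (1+t)·a·√(2/3)`, for `0 < a`, `|t| ≤ 1/100`.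

Proof.  (Pointwise) For `u = q/√18`, `q ∈ hcpInt`, the table `hcpInt_rel` gives `(i, j, Λ, K)`
with `hexIso u = i u₁ + j v₁ + Λ w₁ + K n` (master formula `hexIso_smul_intVec`),
`u₀+u₁+u₂ = √2 K`, and `hexIso (1,1,1) = (3√2/2) n` (`n = √(2/3) e₃`); hence
`hexIso (a • (u + (t √2 K/3) • (1,1,1))) = a • (i u₁ + j v₁ + Λ w₁ + (1+t) K n)`, which is
`barlowPos a h alternatingHagg K i j` (`haggLabel alternatingHagg K = Λ` on the table).
(⊆) The table's `(K, i, j)` are punctured-cluster indices, so `ExactHcpLocal.norm_site_lt_iff`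
(envelope `64/100 a² < h² < 69/100 a²`, valid since `h² = ⅔(1+t)²a²`) gives the norm bound,
and uniform discreteness gives `≠ 0`.  (⊇) A punctured cluster site has one of twelve listed
index triples (`norm_site_lt_iff`), so the right-hand side lies in a finset of cardinality
`≤ 12`, while the image has cardinality `12` (the stretch and `hexIso` are injective); squeeze.

Sources: the tree files `LayeredLawsSelectHcp/Negative/HexCubic.lean`, `…/HcpShells.lean`,
`HullExactificationCascadeExactHcpLocalTheoremShell.lean`; T. C. Hales, *Dense Sphere Packings*,
§1.3 (the hcp pattern).  All statements are coordinate computations, `[folklore]`.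
-/

noncomputable section

namespace Summit.AtomisticToContinuum.Crystallization.Theorems.ShellRigidityHcpBirth

open Literature.Geometry.DiscreteGeometry Literature.MathematicalPhysics.StatisticalMechanics
open Summit.AtomisticToContinuum.Crystallization.Theorems.LayeredLawsSelectHcp.Negative.HexCubic
open Summit.AtomisticToContinuum.Crystallization.Theorems.LayeredLawsSelectHcp.Negative.HcpShells
open Summit.AtomisticToContinuum.Crystallization.Theorems.ExactHcpLocal

/-! ## The envelope of the stretched layer spacing -/

/-- **Envelope**: for `|t| ≤ 1/100` the stretched layer spacing `h = (1+t)a√(2/3)` satisfies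
`64/100 a² < h² < 69/100 a²` (`h² = ⅔(1+t)²a²`, `(1+t)² ∈ [0.9801, 1.0201]`). [folklore] -/
theorem envelope {a t : ℝ} (ha : 0 < a) (ht : |t| ≤ 1 / 100) :
    64 / 100 * a ^ 2 < ((1 + t) * a * Real.sqrt (2 / 3)) ^ 2 ∧
      ((1 + t) * a * Real.sqrt (2 / 3)) ^ 2 < 69 / 100 * a ^ 2 := by
  obtain ⟨ht1, ht2⟩ := abs_le.1 ht
  have hs : Real.sqrt (2 / 3) ^ 2 = 2 / 3 := Real.sq_sqrt (by norm_num)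
  have ha2 : 0 < a ^ 2 := by positivity
  have e : ((1 + t) * a * Real.sqrt (2 / 3)) ^ 2 = (1 + t) ^ 2 * a ^ 2 * (2 / 3) := by
    rw [mul_pow, mul_pow, hs]
  have h1 : 9801 / 10000 ≤ (1 + t) ^ 2 := by nlinarith
  have h2 : (1 + t) ^ 2 ≤ 10201 / 10000 := by nlinarith
  have h1' : 9801 / 10000 * a ^ 2 ≤ (1 + t) ^ 2 * a ^ 2 := mul_le_mul_of_nonneg_right h1 ha2.le
  have h2' : (1 + t) ^ 2 * a ^ 2 ≤ 10201 / 10000 * a ^ 2 := mul_le_mul_of_nonneg_right h2 ha2.le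
  rw [e]
  constructor <;> linarith

/-! ## The frame on the stretched shell -/

/-- The frame carries the hexagonal axis `(1,1,1)` to `√3 e₃ = (3√2/2) · √(2/3) e₃`.
[folklore] -/
theorem hexIso_ones :
    hexIso (intVec ![1, 1, 1]) = (3 * Real.sqrt 2 / 2) • layerNormal (Real.sqrt (2 / 3)) := by
  have e0 : (((![1, 1, 1] : Fin 3 → ℤ) 0 : ℤ) : ℝ) = 1 := by simp
  have e1 : (((![1, 1, 1] : Fin 3 → ℤ) 1 : ℤ) : ℝ) = 1 := by simp
  have e2 : (((![1, 1, 1] : Fin 3 → ℤ) 2 : ℤ) : ℝ) = 1 := by simp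
  have h := hexIso_smul_intVec 1 ![1, 1, 1] 0 0 0 (3 * Real.sqrt 2 / 2)
    (by rw [e0, e1]; ring) (by rw [e0, e1, e2]; ring) (by rw [e0, e1, e2]; ring)
  rw [one_smul] at h
  rw [h, zero_smul, zero_smul, zero_smul, zero_add, zero_add, zero_add]

/-- Rescaling the layer frame: `u_a = a • u_1`, `v_a = a • v_1`, `w_a = a • w_1`,
`n_{c η} = c • n_η`. [folklore] -/
theorem frame_rescale (a c η : ℝ) :
    triangularVec₁ a = a • triangularVec₁ 1 ∧ triangularVec₂ a = a • triangularVec₂ 1 ∧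
      barlowOffset a = a • barlowOffset 1 ∧ layerNormal (c * η) = c • layerNormal η := by
  refine ⟨?_, ?_, ?_, ?_⟩ <;> ext l <;> fin_cases l <;>
    simp [triangularVec₁, triangularVec₂, barlowOffset, layerNormal] <;> ring

/-- **The frame on a stretched shell point.** For `u = q/√18 ∈ hcpKissingPattern` with table
entry `(i, j, Λ, K) ∈ hcpOffsetIdx`:
`hexIso (a • (u + (t (u₀+u₁+u₂)/3) • (1,1,1))) = barlowPos a ((1+t)a√(2/3)) alternatingHagg K i j`.
[folklore] -/
theorem hexIso_stretch (a t : ℝ) {u : EuclideanSpace ℝ (Fin 3)} (hu : u ∈ hcpKissingPattern) :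
    ∃ idx ∈ hcpOffsetIdx,
      hexIso (a • (u + (t * (u 0 + u 1 + u 2) / 3) • intVec ![1, 1, 1])) =
        barlowPos a ((1 + t) * a * Real.sqrt (2 / 3)) alternatingHagg idx.2.2.2 idx.1 idx.2.1 := by
  obtain ⟨p, hp, hpu⟩ := Finset.mem_image.1 hu
  obtain ⟨idx, hidx, r1, r2, r3⟩ := hcpInt_rel p hp
  refine ⟨idx, hidx, ?_⟩
  have hc : (Real.sqrt ((18 : ℕ) : ℝ))⁻¹ * Real.sqrt 2 = 1 / 3 := by
    rw [Nat.cast_ofNat]; exact inv_sqrt_eighteen_mul_sqrt_two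
  have r1' : ((p 0 : ℤ) : ℝ) - p 1 = 3 * (2 * idx.1 + idx.2.1 + idx.2.2.1) := by exact_mod_cast r1
  have r2' : -((p 0 : ℤ) : ℝ) - p 1 + 2 * p 2 = 3 * (3 * idx.2.1 + idx.2.2.1) := by
    exact_mod_cast r2
  have r3' : ((p 0 : ℤ) : ℝ) + p 1 + p 2 = 6 * idx.2.2.2 := by exact_mod_cast r3
  -- the frame on the unstretched point (as in `hexIso_hcpPattern`)
  have hM : hexIso u =
      (idx.1 : ℝ) • triangularVec₁ 1 + (idx.2.1 : ℝ) • triangularVec₂ 1 +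
        (idx.2.2.1 : ℝ) • barlowOffset 1 + (idx.2.2.2 : ℝ) • layerNormal (Real.sqrt (2 / 3)) := by
    rw [← hpu]
    refine hexIso_smul_intVec _ p _ _ _ _ ?_ ?_ ?_
    · rw [r1', ← mul_assoc, hc]; ring
    · rw [r2', ← mul_assoc, hc]; ring
    · rw [r3', ← mul_assoc, hc]; ring
  -- the stretch coefficient along `hexIso (1,1,1) = (3√2/2) n`: `t (u₀+u₁+u₂)/3 · 3√2/2 = t K`
  have hcoef : t * (u 0 + u 1 + u 2) / 3 * (3 * Real.sqrt 2 / 2) = t * idx.2.2.2 := by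
    have hsum : u 0 + u 1 + u 2 =
        (Real.sqrt ((18 : ℕ) : ℝ))⁻¹ * (((p 0 : ℤ) : ℝ) + p 1 + p 2) := by
      rw [← hpu, PiLp.smul_apply, PiLp.smul_apply, PiLp.smul_apply, intVec_apply, intVec_apply,
        intVec_apply, smul_eq_mul, smul_eq_mul, smul_eq_mul]
      ring
    rw [hsum, r3']
    linear_combination (3 * t * (idx.2.2.2 : ℝ)) * hc
  -- the letter of layer `K` is `Λ` on the table
  have hΛ : (haggLabel alternatingHagg idx.2.2.2 : ℝ) = idx.2.2.1 := by
    rcases hcpOffsetIdx_shape idx hidx with ⟨hK, hL⟩ | ⟨hK, hL⟩ | ⟨hK, hL⟩ <;> rw [hK, hL]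
    · rw [haggLabel_zero]
    · rw [haggLabel_alternating_of_odd odd_one]
    · rw [haggLabel_alternating_of_odd (by decide)]
  obtain ⟨e1, e2, e3, e4⟩ := frame_rescale a ((1 + t) * a) (Real.sqrt (2 / 3))
  rw [LinearIsometry.map_smul, LinearIsometry.map_add, LinearIsometry.map_smul, hM, hexIso_ones,
    smul_smul, hcoef, barlowPos, hΛ, e1, e2, e3, e4]
  module

/-! ## The two inclusions and the count -/

/-- The table's `(K, i, j)` are punctured-cluster indices in the linear form of
`ExactHcpLocal.norm_site_lt_iff` (hexagon: `K = 0`; caps: `K = ±1`), and never `(0,0,0)`.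
[folklore] -/
theorem hcpOffsetIdx_cluster : ∀ idx ∈ hcpOffsetIdx,
    ((idx.2.2.2 = 0 ∧ -1 ≤ idx.1 ∧ idx.1 ≤ 1 ∧ -1 ≤ idx.2.1 ∧ idx.2.1 ≤ 1 ∧
        -1 ≤ idx.1 + idx.2.1 ∧ idx.1 + idx.2.1 ≤ 1) ∨
      ((idx.2.2.2 = 1 ∨ idx.2.2.2 = -1) ∧ -1 ≤ idx.1 ∧ idx.1 ≤ 0 ∧ -1 ≤ idx.2.1 ∧
        idx.2.1 ≤ 0 ∧ -1 ≤ idx.1 + idx.2.1)) ∧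
      (idx.2.2.2, idx.1, idx.2.1) ≠ ((0 : ℤ), (0 : ℤ), (0 : ℤ)) := by
  decide

/-- **(⊆)**: the frame carries each stretched shell point to a punctured-cluster site of the
stretched crystal. [folklore] -/
theorem image_subset {a t : ℝ} (ha : 0 < a) (ht : |t| ≤ 1 / 100) :
    (↑((hcpKissingPattern.image fun u : EuclideanSpace ℝ (Fin 3) =>
          a • (u + (t * (u 0 + u 1 + u 2) / 3) • intVec ![1, 1, 1])).image hexIso) :
        Set (EuclideanSpace ℝ (Fin 3))) ⊆
      {p : EuclideanSpace ℝ (Fin 3) |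
        p ∈ hcpStacking a ((1 + t) * a * Real.sqrt (2 / 3)) ∧ p ≠ 0 ∧ ‖p‖ < 13 / 10 * a} := by
  obtain ⟨hh1, hh2⟩ := envelope ha ht
  have hh : 0 < (1 + t) * a * Real.sqrt (2 / 3) :=
    mul_pos (mul_pos (by linarith [(abs_le.1 ht).1]) ha) (Real.sqrt_pos.2 (by norm_num))
  intro p hp
  obtain ⟨x, hx, rfl⟩ := Finset.mem_image.1 (Finset.mem_coe.1 hp)
  obtain ⟨u, hu, rfl⟩ := Finset.mem_image.1 hx
  obtain ⟨idx, hidx, hEq⟩ := hexIso_stretch a t hu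
  obtain ⟨hL, hne⟩ := hcpOffsetIdx_cluster idx hidx
  rw [Set.mem_setOf_eq, hEq]
  refine ⟨barlowPos_mem _ _ _, fun h0 => ?_, (norm_site_lt_iff ha hh1 hh2 _ _ _).2 hL⟩
  have hd :=
    le_dist_barlowPos a ((1 + t) * a * Real.sqrt (2 / 3)) alternatingHagg ha.le hh.le hne
  rw [h0, barlowPos_alternating_zero, dist_self] at hd
  exact absurd hd (not_le.2 (lt_min ha hh))

/-- **(⊇, in indices)**: a punctured-cluster site of the stretched crystal is one of twelve listed
sites (the hexagon `(0,±1,0), (0,0,±1), (0,1,−1), (0,−1,1)` and the caps `(±1,0,0), (±1,−1,0),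
(±1,0,−1)`). [folklore] -/
theorem rhs_subset {a t : ℝ} (ha : 0 < a) (ht : |t| ≤ 1 / 100) :
    {p : EuclideanSpace ℝ (Fin 3) |
        p ∈ hcpStacking a ((1 + t) * a * Real.sqrt (2 / 3)) ∧ p ≠ 0 ∧ ‖p‖ < 13 / 10 * a} ⊆
      ↑((({(0, 1, 0), (0, -1, 0), (0, 0, 1), (0, 0, -1), (0, 1, -1), (0, -1, 1), (1, 0, 0),
            (1, -1, 0), (1, 0, -1), (-1, 0, 0), (-1, -1, 0), (-1, 0, -1)} :
            Finset (ℤ × ℤ × ℤ)).image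
          fun x : ℤ × ℤ × ℤ =>
            barlowPos a ((1 + t) * a * Real.sqrt (2 / 3)) alternatingHagg x.1 x.2.1 x.2.2)) := by
  obtain ⟨hh1, hh2⟩ := envelope ha ht
  rintro p ⟨⟨k, i, j, rfl⟩, hne, hlt⟩
  have hL := (norm_site_lt_iff ha hh1 hh2 k i j).1 hlt
  have h0 : ¬ (k = 0 ∧ i = 0 ∧ j = 0) := by
    rintro ⟨rfl, rfl, rfl⟩
    exact hne (barlowPos_alternating_zero _ _)
  refine Finset.mem_coe.2 (Finset.mem_image.2 ⟨(k, i, j), ?_, rfl⟩)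
  clear hne hlt
  -- reduce to the 9 + 8 concrete index triples, kill the non-cluster ones, decide membership
  rcases hL with ⟨rfl, hi1, hi2, hj1, hj2, hs1, hs2⟩ | ⟨hk, hi1, hi2, hj1, hj2, hs1⟩
  · interval_cases i <;> interval_cases j <;> first | (exfalso; omega) | simp
  · rcases hk with rfl | rfl <;> interval_cases i <;> interval_cases j <;>
      first | (exfalso; omega) | simp

/-- The stretch `u ↦ a • (u + (t(u₀+u₁+u₂)/3) • (1,1,1))` is injective (`a ≠ 0`, `t ≠ −1`).
[folklore] -/
theorem stretch_injective {a t : ℝ} (ha : 0 < a) (ht : |t| ≤ 1 / 100) :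
    Function.Injective fun u : EuclideanSpace ℝ (Fin 3) =>
      a • (u + (t * (u 0 + u 1 + u 2) / 3) • intVec ![1, 1, 1]) := by
  intro u v huv
  have h' : u + (t * (u 0 + u 1 + u 2) / 3) • intVec ![1, 1, 1] =
      v + (t * (v 0 + v 1 + v 2) / 3) • intVec ![1, 1, 1] :=
    smul_right_injective (EuclideanSpace ℝ (Fin 3)) ha.ne' huv
  have hc : ∀ l : Fin 3, u l + t * (u 0 + u 1 + u 2) / 3 = v l + t * (v 0 + v 1 + v 2) / 3 := by
    intro l
    have hl := congrArg (fun x : EuclideanSpace ℝ (Fin 3) => x l) h'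
    have h1 : (((![1, 1, 1] : Fin 3 → ℤ) l : ℤ) : ℝ) = 1 := by fin_cases l <;> simp
    simpa [h1] using hl
  obtain ⟨ht1, -⟩ := abs_le.1 ht
  have hs : u 0 + u 1 + u 2 = v 0 + v 1 + v 2 := by
    have hprod : (1 + t) * ((u 0 + u 1 + u 2) - (v 0 + v 1 + v 2)) = 0 := by
      linear_combination hc 0 + hc 1 + hc 2
    rcases mul_eq_zero.1 hprod with h1 | h1
    · linarith
    · linarith
  ext l
  have hl := hc l
  rw [hs] at hl
  linarith

/-- The image finset has twelve points. [folklore] -/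
theorem card_image {a t : ℝ} (ha : 0 < a) (ht : |t| ≤ 1 / 100) :
    ((hcpKissingPattern.image fun u : EuclideanSpace ℝ (Fin 3) =>
        a • (u + (t * (u 0 + u 1 + u 2) / 3) • intVec ![1, 1, 1])).image hexIso).card = 12 := by
  rw [Finset.card_image_of_injective _ hexIso.injective,
    Finset.card_image_of_injective _ (stretch_injective ha ht), card_hcpKissingPattern]

/-- Squeeze: `↑P ⊆ S ⊆ ↑Q` with `#Q ≤ #P` forces `↑P = S`. [folklore] -/
theorem coe_eq_of_squeeze {α : Type*} {P Q : Finset α} {S : Set α}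
    (hPS : (↑P : Set α) ⊆ S) (hSQ : S ⊆ ↑Q) (hcard : Q.card ≤ P.card) : (↑P : Set α) = S := by
  have hPQ : P ⊆ Q := Finset.coe_subset.1 (hPS.trans hSQ)
  have hEq : P = Q := Finset.eq_of_subset_of_card_le hPQ hcard
  refine Set.Subset.antisymm hPS ?_
  rw [hEq]
  exact hSQ

/-! ## The stub -/

/-- **stub_shellIdentification** (the stretched shell IS the first shell of the stretched crystal):
a linear isometry `B` of `ℝ³` (the close-packing frame `hexIso`: hexagonal axis `(1,1,1)/√3 ↦ e₃`)
carries `S(a,t) = hcpKissingPattern.image (u ↦ a • (u + (t (u₀+u₁+u₂)/3) • (1,1,1)))` onto the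
punctured `13/10 a`-cluster of the origin in `hcpStacking a ((1+t)·a·√(2/3))` (six hexagon sites
at distance `a`, six cap sites at `√(a²/3 + h²)`). [folklore] -/
theorem stub_shellIdentification :
    ∀ a t : ℝ, 0 < a → |t| ≤ 1 / 100 →
      ∃ B : EuclideanSpace ℝ (Fin 3) →ₗᵢ[ℝ] EuclideanSpace ℝ (Fin 3),
        (↑((hcpKissingPattern.image fun u =>
              a • (u + (t * (u 0 + u 1 + u 2) / 3) • intVec ![1, 1, 1])).image B) :
            Set (EuclideanSpace ℝ (Fin 3))) =
          {p : EuclideanSpace ℝ (Fin 3) |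
            p ∈ hcpStacking a ((1 + t) * a * Real.sqrt (2 / 3)) ∧ p ≠ 0 ∧ ‖p‖ < 13 / 10 * a} := by
  intro a t ha ht
  refine ⟨hexIso, coe_eq_of_squeeze (image_subset ha ht) (rhs_subset ha ht) ?_⟩
  rw [card_image ha ht]
  exact Finset.card_image_le.trans (by decide)

end Summit.AtomisticToContinuum.Crystallization.Theorems.ShellRigidityHcpBirth

end
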